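import Summits.HodgeConjecture.HodgeConjecture.Theorems.LinearSystemTorelliLocalTubeSpanPairMoves
import Mathlib.Tactic.Module

/-!
# Route LinearSystemTorelli — crux `LocalTubeSpan` (stmt-HodgeConjecture-2490): peeling one partner component off a squared transvection

Helper file (`--supports stmt-HodgeConjecture-2490`, line `Sketch` of the crux chain, cycle 9,
continuation lead c7; the lead's stub `stub_squares_peel`, worker S3).  Cycle 9, Part A, shows that
for a skew vanishing lattice `Δ` EVERY square `T_a²`, `a ∈ ℤΔ`, of a transvection along a lattice
vector is monodromy; this file is the PEEL step of that induction.

Setting: an alternating form `B` on a `ℚ`-space `V`, a skew vanishing lattice `Δ`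
(`IsSkewVanishingLattice`, lattice `ℤΔ := Submodule.span ℤ Δ`, monodromy group
`Γ_Δ = transvectionGroup B Δ` generated by the transvections `T_δ v = v - B(v, δ) δ`, `δ ∈ Δ`), a
unimodular pair `u, w ∈ Δ`, `B(u, w) = 1`.  Write `𝒯₂` for the set of vectors `x` such that some
element of `Γ_Δ` acts as `T_x² : v ↦ v - 2 B(v, x) x`.  Granting
* the SQUARE STEP (hypothesis `hstep`, the neighbouring stub `stub_squares_step`): for `δ ∈ Δ` and a
  lattice vector `x ⟂ δ`, `x ∈ 𝒯₂ ↔ x + δ ∈ 𝒯₂`;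
* the STRIP (hypothesis `hstrip`, the neighbouring stub `stub_squares_strip`): for a lattice vector
  `m ⟂ u, w` and integers `α, β`, `m ∈ 𝒯₂ ↔ α u + β w + m ∈ 𝒯₂`;

MAIN THEOREM `localTubeSpan_squares_peel`: for lattice vectors `m, n' ⟂ u, w` with `w + n' ∈ Δ`
one has `m ∈ 𝒯₂ ↔ m - n' ∈ 𝒯₂`.

Proof.  Let `c := B(m, n') ∈ ℤ` (integrality) and `δ := -u + c w + n'`.
* `δ ∈ Δ`: `T_w⁻¹ T_u⁻¹ (w + n') = -u + n'` lies in `Δ` (stability of `Δ` under `Γ_Δ`), and the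
  integral shear `v ↦ v - c B(v, w) w` of `Γ_Δ` (`localTubeSpan_pairMoves_shear_mem`) maps it to `δ`.
* `δ ⟂ x' := -c w + (m - n')`: `B(δ, x') = c B(u, w) + B(n', m) = c - c = 0`.
* `x' + δ = -u + m`, so the step gives `x' ∈ 𝒯₂ ↔ -u + m ∈ 𝒯₂`; the strip with `(α, β) = (-1, 0)`
  gives `m ∈ 𝒯₂ ↔ -u + m ∈ 𝒯₂`, and with `(α, β) = (0, -c)` at `m - n'` it gives
  `m - n' ∈ 𝒯₂ ↔ x' ∈ 𝒯₂`.  Chain the three equivalences.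

References: [Janssen1983] W. A. M. Janssen, *Skew-symmetric vanishing lattices and their monodromy
groups*, Math. Ann. 266 (1983), Thm. 2.5; [Schnell2010] C. Schnell, *Primitive cohomology and the
tube mapping*, Math. Z. 268 (2010) §7.  No named facts; no `sorry`.
-/

-- `Summit.HodgeConjecture.HodgeConjecture.Theorems` is the mandated namespace (single-conjunct summit:
-- Sub = Summit), which `linter.dupNamespace` flags on every declaration; the lakefile turns the
-- linter off tree-wide (weak option), restated here so stand-alone elaboration is warning-free too.
set_option linter.dupNamespace false

noncomputable section

open Literature.AlgebraicGeometry.HodgeTheory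

namespace Summit.HodgeConjecture.HodgeConjecture.Theorems

variable {V : Type} [AddCommGroup V] [Module ℚ V]

/-! ### The vanishing cycle `-u + c w + n'` -/

section Cycle

variable (B : LinearMap.BilinForm ℚ V) (hB : B.IsAlt) (Δ : Set V)

include hB in
/-- For a unimodular pair `u, w ∈ Δ` (`B(u, w) = 1`) of a skew vanishing lattice and `n' ⟂ u, w`
with `w + n' ∈ Δ`, the vector `-u + n' = T_w⁻¹ T_u⁻¹ (w + n')` is a vanishing cycle. [folklore] -/
theorem localTubeSpan_squares_peel_neg_add_mem (hΔ : IsSkewVanishingLattice B Δ) {u w n' : V}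
    (hu : u ∈ Δ) (hw : w ∈ Δ) (huw : B u w = 1) (hun' : B u n' = 0) (hwn' : B w n' = 0)
    (hwn'Δ : w + n' ∈ Δ) : -u + n' ∈ Δ := by
  obtain ⟨tu, htuΓ, htu⟩ := localTubeSpan_pairMoves_unit_mem B hB Δ hu
  obtain ⟨tw, htwΓ, htw⟩ := localTubeSpan_pairMoves_unit_mem B hB Δ hw
  have hwu : B w u = -1 := by rw [← hB.neg_eq, huw]
  have hn'u : B n' u = 0 := by rw [← hB.neg_eq, hun', neg_zero]
  have hn'w : B n' w = 0 := by rw [← hB.neg_eq, hwn', neg_zero]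
  have e : ((tw⁻¹ * tu⁻¹ : (V →ₗ[ℚ] V)ˣ) : V →ₗ[ℚ] V) (w + n') = -u + n' := by
    rw [Units.val_mul, Module.End.mul_apply, localTubeSpan_unit_inv_apply B htu (hB.self_eq_zero u),
      localTubeSpan_unit_inv_apply B htw (hB.self_eq_zero w)]
    simp only [map_add, map_smul, LinearMap.add_apply, LinearMap.smul_apply, smul_eq_mul, hwu,
      hn'u, hn'w, huw, hB.self_eq_zero]
    module
  rw [← e]
  exact hΔ.stable _ (mul_mem (inv_mem htwΓ) (inv_mem htuΓ)) _ hwn'Δ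

include hB in
/-- For a unimodular pair `u, w ∈ Δ` of a skew vanishing lattice, `n' ⟂ u, w` with `w + n' ∈ Δ` and
`c ∈ ℤ`, the vector `-u + c w + n'` (the image of `-u + n'` under the shear `v ↦ v - c B(v, w) w` of
`Γ_Δ`) is a vanishing cycle. [folklore] -/
theorem localTubeSpan_squares_peel_cycle_mem (hΔ : IsSkewVanishingLattice B Δ) {u w n' : V}
    (hu : u ∈ Δ) (hw : w ∈ Δ) (huw : B u w = 1) (hun' : B u n' = 0) (hwn' : B w n' = 0)
    (hwn'Δ : w + n' ∈ Δ) (c : ℤ) : -u + (c : ℚ) • w + n' ∈ Δ := by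
  obtain ⟨g, hgΓ, hg⟩ := localTubeSpan_pairMoves_shear_mem B hB Δ hw (-c)
  have hn'w : B n' w = 0 := by rw [← hB.neg_eq, hwn', neg_zero]
  have e : (g : V →ₗ[ℚ] V) (-u + n') = -u + (c : ℚ) • w + n' := by
    rw [hg]
    simp only [map_add, map_neg, LinearMap.add_apply, LinearMap.neg_apply, huw, hn'w]
    push_cast
    module
  rw [← e]
  exact hΔ.stable _ hgΓ _
    (localTubeSpan_squares_peel_neg_add_mem B hB Δ hΔ hu hw huw hun' hwn' hwn'Δ)

end Cycle

/-! ### The peel -/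

/-- **Peel one partner component** (cycle 9, stub `stub_squares_peel`).  For a skew vanishing
lattice `Δ`, a unimodular pair `u, w ∈ Δ` (`B(u, w) = 1`) and lattice vectors `m, n' ⟂ u, w` with
`w + n' ∈ Δ`: granting the square step (`x ∈ 𝒯₂ ↔ x + δ ∈ 𝒯₂` for `δ ∈ Δ ⟂ x`) and the strip
(`m ∈ 𝒯₂ ↔ α u + β w + m ∈ 𝒯₂` for `m ⟂ u, w`), some element of `Γ_Δ` acts as `T_m²` iff some
element acts as `T_{m-n'}²`.  (`c := B(m, n')`; the cycle `δ := -u + c w + n' ∈ Δ` is orthogonal to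
`x' := -c w + (m - n')` and `x' + δ = -u + m`; step once, strip twice.) [folklore] -/
theorem localTubeSpan_squares_peel (B : LinearMap.BilinForm ℚ V) (hB : B.IsAlt) (Δ : Set V)
    (hΔ : IsSkewVanishingLattice B Δ) {u w : V} (hu : u ∈ Δ) (hw : w ∈ Δ) (huw : B u w = 1)
    (hstep : ∀ δ ∈ Δ, ∀ x ∈ Submodule.span ℤ Δ, B δ x = 0 →
      ((∃ g ∈ transvectionGroup B Δ, ∀ v : V,
          ((g : (V →ₗ[ℚ] V)ˣ) : V →ₗ[ℚ] V) v = v - (2 : ℚ) • (B v x • x)) ↔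
       (∃ g ∈ transvectionGroup B Δ, ∀ v : V,
          ((g : (V →ₗ[ℚ] V)ˣ) : V →ₗ[ℚ] V) v = v - (2 : ℚ) • (B v (x + δ) • (x + δ)))))
    (hstrip : ∀ m ∈ Submodule.span ℤ Δ, B u m = 0 → B w m = 0 → ∀ α β : ℤ,
      ((∃ g ∈ transvectionGroup B Δ, ∀ v : V,
          ((g : (V →ₗ[ℚ] V)ˣ) : V →ₗ[ℚ] V) v = v - (2 : ℚ) • (B v m • m)) ↔
       (∃ g ∈ transvectionGroup B Δ, ∀ v : V,
          ((g : (V →ₗ[ℚ] V)ˣ) : V →ₗ[ℚ] V) v =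
            v - (2 : ℚ) • (B v ((α : ℚ) • u + (β : ℚ) • w + m) • ((α : ℚ) • u + (β : ℚ) • w + m)))))
    {m n' : V} (hm : m ∈ Submodule.span ℤ Δ) (hum : B u m = 0) (hwm : B w m = 0)
    (hn' : n' ∈ Submodule.span ℤ Δ) (hun' : B u n' = 0) (hwn' : B w n' = 0) (hwn'Δ : w + n' ∈ Δ) :
    (∃ g ∈ transvectionGroup B Δ, ∀ v : V,
        ((g : (V →ₗ[ℚ] V)ˣ) : V →ₗ[ℚ] V) v = v - (2 : ℚ) • (B v m • m)) ↔
    (∃ g ∈ transvectionGroup B Δ, ∀ v : V,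
        ((g : (V →ₗ[ℚ] V)ˣ) : V →ₗ[ℚ] V) v = v - (2 : ℚ) • (B v (m - n') • (m - n'))) := by
  -- `c := B(m, n') ∈ ℤ`
  obtain ⟨c, hc⟩ := localTubeSpan_integral_span B Δ hΔ.integral hm hn'
  have hn'm : B n' m = -(c : ℚ) := by rw [← hB.neg_eq, hc]
  have hn'w : B n' w = 0 := by rw [← hB.neg_eq, hwn', neg_zero]
  -- the cycle `δ := -u + c w + n' ∈ Δ`
  have hδ : -u + (c : ℚ) • w + n' ∈ Δ :=
    localTubeSpan_squares_peel_cycle_mem B hB Δ hΔ hu hw huw hun' hwn' hwn'Δ c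
  -- the lattice vector `x' := -c w + (m - n') ⟂ δ`
  have hx' : -(c : ℚ) • w + (m - n') ∈ Submodule.span ℤ Δ := by
    refine Submodule.add_mem _ ?_ (Submodule.sub_mem _ hm hn')
    rw [neg_smul]
    exact Submodule.neg_mem _ (localTubeSpan_intCast_smul_mem Δ (Submodule.subset_span hw) c)
  have horth : B (-u + (c : ℚ) • w + n') (-(c : ℚ) • w + (m - n')) = 0 := by
    simp only [map_add, map_sub, map_neg, map_smul, LinearMap.add_apply, LinearMap.neg_apply,
      LinearMap.smul_apply, smul_eq_mul, huw, hum, hun', hwm, hwn', hn'w, hn'm, hB.self_eq_zero]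
    ring
  -- step once, strip twice
  have h1 := hstrip m hm hum hwm (-1) 0
  have h2 := hstep _ hδ _ hx' horth
  have h3 := hstrip (m - n') (Submodule.sub_mem _ hm hn') (by rw [map_sub, hum, hun', sub_zero])
    (by rw [map_sub, hwm, hwn', sub_zero]) 0 (-c)
  have e1 : ((-1 : ℤ) : ℚ) • u + ((0 : ℤ) : ℚ) • w + m = -u + m := by push_cast; module
  have e2 : -(c : ℚ) • w + (m - n') + (-u + (c : ℚ) • w + n') = -u + m := by module
  have e3 : ((0 : ℤ) : ℚ) • u + ((-c : ℤ) : ℚ) • w + (m - n') = -(c : ℚ) • w + (m - n') := by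
    push_cast; module
  rw [e1] at h1
  rw [e2] at h2
  rw [e3] at h3
  exact h1.trans (h2.symm.trans h3.symm)

end Summit.HodgeConjecture.HodgeConjecture.Theorems

end
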